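import Literature.MathematicalPhysics.QuantumFieldTheory.Balaban1983to89.B9Thm311ProjectionR

/-!
# `Balaban1983to89.Node00.OpsYSectDESymm` — [B9] Sect. D∕E: def-Y's letters `G = G̃` (3.122), `G₁` (3.128) and `𝔊 = 𝔓G₁` (3.153) ARE SYMMETRIC
# for the trace pairing at `G`-valued configurations (`G ≤ U(N)`), at ANY tables and at the v4 record `lettersYOfRecordV4`

T. Bałaban, *Propagators for lattice gauge theories in a background field*, Commun. Math. Phys. **99** (1985) 389–434
[`Balaban1985BackgroundPropagators`, "B9"].

statement-level skeleton of published theorems with citation tags; proofs where landed; nothing here is a claim about the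
Yang–Mills mass gap

THE PRINTED LOCI (verbatim).  p. 419, (3.119): *"⟨A, Δ_π A⟩ = ⟨A − DG′RD\*A, Δ(A − DG′RD\*A)⟩"* — a quadratic FORM, i.e. a symmetric operator;
p. 420, (3.122): *"G̃⁻¹ = Δ_π + DRD\* + Q\*aQ"*; p. 421: *"G₁ is a positive operator for γ sufficiently small"* ((3.128)–(3.129)); p. 426, (3.153):
*"𝔊 = 𝔓G₁ = G₁ − G₁Q\*(QG₁Q\*)⁻¹QG₁ − G₁DRD\*G₁ = G₁𝔓\*"* — the two expressions `𝔓G₁ = G₁𝔓\*` agree BECAUSE `G₁`, `(QG₁Q\*)⁻¹` and `DRD\*` are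
symmetric; p. 416 (Thm 3.11): *"It is a symmetric … operator"*; p. 392, (3.8): `D\*` the adjoint of `D`; p. 393, (3.13): `Q\*(U)` the adjoint of `Q(U)`.

WHY THIS FILE.  The N06 certificate of record (`Summits/…/BalabanUVNodesN06AtOpsYNuOfRecordV6EPairMC`, edition 8, binder `hsymD` :186 — `GD ∧ G₁ ∧ GG`;
edition 7 `…V6EPairMT` :208 had `GD ∧ G₁`) displays ONE letter property it cannot prove from the pins: the trace-symmetry of def-Y's composite Sect. D∕E letters `GD U`, `G₁ U`, `GG U`
of `lettersYOfRecordV4 N θ M⋆ 𝔯 x` at a special-unitary configuration `U` (it feeds the six transposition clauses of rows 20–21 through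
`isTransposePair_GcoK_trBasis`).  dag-n06-j's symmetry engine (`B9Thm311AdjointPairs`: (3.8), (3.9), (3.13) as adjoint pairs, adjoint sandwiches,
`RY_isSymmTr`; `B9Thm311Curv2Symm`: the Hessian's commutator part; `B9Thm311SymmAtRecordV4`: `symm0 ∕ adj ∕ symmG` at `parSymY`; `B9Thm311ProjectionR`: `R(U)` at `parSymY` symmetric) and dag-n06-i's
`isSymmTr_ringInverse` ∕ `isSymmTr_GpY_parSymY` (`B9Ineq349SiteAdjoint`) prove everything about the Sect. A–C letters; THIS FILE runs the same algebra
through the Sect. D∕E letters, which are def-Y's (`Node00.OpsYSectDE`: `delta2PiY deltaOneY G1Y QG1QinvY frakPY GGY`) and dag-n06-i's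
(`B9Eq3132SectDLetters`: `gaugePiY gaugePiTY deltaPiY deltaPiAY GDY`), all cited BY NAME — nothing restated.

THE ONE NEW MECHANISM.  ★ `isAdjTr_gaugePiY_gaugePiTY`: print's `1 − DRG′D\*` IS the trace-adjoint of `1 − DG′RD\*` at a unitary-valued configuration
whenever `G′(U)` and `R(U)` are symmetric (adjoints compose in reverse order: `isAdjTr_comp`, `isAdjTr_sub`).  Hence `Δ_π = (1 − DRG′D\*)Δ(1 − DG′RD\*)`
(3.119) and `Δ⁽²⁾_π = π†Δ⁽²⁾π` (3.135) are ADJOINT SANDWICHES (`isSymmTr_sandwich_of_isAdjTr`) of the symmetric `Δ(U)` (`hessY_isSymmTr`: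
`coCurlY_jordanY_curlY_isSymmTr` + `curv2Y_isSymmTr`) resp. of `Δ⁽²⁾(U)`; `G̃⁻¹ = Δ_π + DRD\* + Q\*aQ` and `G₁⁻¹ = G̃⁻¹ − Δ⁽²⁾_π` are sums of symmetric
operators, their `Ring.inverse`s `G`, `G₁` are symmetric (`isSymmTr_ringInverse`, invertible or not), `(QG₁Q\*)⁻¹` is symmetric (another sandwich,
(3.13)), and (3.153) exhibits `𝔊` as `G₁` minus two sandwiches by the symmetric `G₁`.

* §1 generic pairing algebra: `isAdjTr_id`, `isAdjTr_sub`, `isAdjTr_comp` (adjoints of differences ∕ composites), `isAdjTr_of_isSymmTr`.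
* §2 at ANY tables `(parS, parB, Gp)` and residual letter `Δ2`, unitary-valued `U`, displayed inputs `hGp : G′(U) symmetric`, `hR : R(U) symmetric`,
  `hparB : parB(U) ∈ G`, `hΔ2 : Δ⁽²⁾(U) symmetric`: ★ `isAdjTr_gaugePiY_gaugePiTY`, `hessY_isSymmTr`, ★ `deltaPiY_isSymmTr` ((3.119)),
  `deltaPiAY_isSymmTr` ((3.122)), ★★ `GDY_isSymmTr` (Sect. D's `G`), `delta2PiY_isSymmTr` ((3.135)), `deltaOneY_isSymmTr` ((3.128)), ★★ `G1Y_isSymmTr`,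
  `QGQOfY_isSymmTr` ∕ `QGQinvOfY_isSymmTr` ((3.123)∕(3.132) for any symmetric letter), `QG1QinvY_isSymmTr`, ★★ `GGY_isSymmTr` ((3.153)).
* §3 at def-Y's symmetrised tables `parSymY ∕ parBY ∕ GpY` for a `G`-valued configuration (`hGp`, `hR`, `hparB` DISCHARGED by dag-n06-i's
  `isSymmTr_GpY_parSymY`, dag-n06-j's `B9Thm311ProjectionR.RY_parSymY_isSymmTr`, def-Y's `parBY_mem`): ★★ `GDY_isSymmTr_parSymY`, `G1Y_isSymmTr_parSymY`,
  `GGY_isSymmTr_parSymY`.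
* §4 at the v4 record `lettersYOfRecordV4 N θ M⋆ 𝔯` (fields `GD ∕ G₁ ∕ GG` are §3's operators by `rfl`): ★★★ `lettersYOfRecordV4_GD_isSymmTr` (NO residual
  hypothesis), `lettersYOfRecordV4_G₁_isSymmTr` ∕ `lettersYOfRecordV4_GG_isSymmTr` (modulo `IsSymmTr 1 ((𝔯 x).Δ2 U)`), the certificate-shaped bundles
  ★★★ `lettersYOfRecordV4_symmDG₁` (edition 7's `hsymD`) and `lettersYOfRecordV4_symmDG₁GG` (edition 8's), both from ONE displayed hypothesis
  `hΔ2 : ∀ x U, (∀ μ z, U μ z ∈ SU(N)) → IsSymmTr 1 ((𝔯 x).Δ2 U)` on the residual PARAMETER; `isSymmTr_zero`, `resLettersY_flat_Δ2_isSymmTr` ∕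
  `resY_flat_Δ2_isSymmTr`: the flat residual family satisfies it, so at `𝔯 := resY_flat` the bundle is UNCONDITIONAL
  (`lettersYOfRecordV4_flat_symmDG₁GG`).  0 `def`, theorems only.

HONEST SCOPE.  Finite-dimensional trace algebra at def-Y's genuine operators; the residual letter `Δ⁽²⁾ = (𝔯 x).Δ2` is a PARAMETER of the record
(`ResLettersY` types only its `U = 1` clause; the genuine (3.134) needs [5]'s `C⁽²⁾` and `J`, not objects of the tree), so its symmetry is a DISPLAYED
hypothesis, never hidden, and is proved only for the flat family.  No invertibility is assumed anywhere (`Ring.inverse` of a non-unit is `0`, symmetric).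
NOT a node discharge, NOT summit progress; count-neutral; nothing continuum, nothing about reflection positivity or the mass gap.  Cell `pub-ymgap`
(HUMAN RULING D-0062), Track A node N06 [B9] ∕ NODE 00 definer row def-Y (successor gen 8), 2026-08-27.
-/

noncomputable section

namespace Literature.MathematicalPhysics.QuantumFieldTheory.Balaban1983to89.Node00

open B6KLevelCensusIndexV1 (KIdx)
open B9PinMembersKLevelV1 (MemberY)
open B7Prop2SpecialUnitary (specialUnitaryUnits specialUnitaryUnits_le_unitaryUnits)
open B9Thm311ReadingCoords (trIP IsSymmTr IsAdjTr)
open B9Thm311ReadingAtLetters (wB)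
open B9Thm311DeltaPrimeSymm (isSymmTr_add)
open B9Thm311AdjointPairs (isAdjTr_swap isAdjTr_reverse isSymmTr_sandwich_of_isAdjTr isSymmTr_comp_self isSymmTr_sub isSymmTr_id isAdjTr_gradY_divY
  isAdjTr_QY_QsY RY_isSymmTr gradY_RY_divY_isSymmTr coCurlY_jordanY_curlY_isSymmTr isSymmTr_QsY_aY_QY aK_isSymm)
open B9Thm311Curv2Symm (curv2Y_isSymmTr)
open B9Thm311SymmAtRecordV4 (adj_parSymY)
open B9Thm311ProjectionR (RY_parSymY_isSymmTr)
open B9Ineq349SiteAdjoint (isSymmTr_ringInverse isSymmTr_GpY_parSymY)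
open B9Eq3132SectDLetters (gaugePiY gaugePiTY deltaPiY deltaPiAY GDY)
open scoped Matrix

/-! ## §1 Generic pairing algebra: adjoints of the identity, of differences, of composites -/

section Generic

variable {N : ℕ} {X Y Z : Type} [Fintype X] [Fintype Y] [Fintype Z]

/-- the identity is its own adjoint. [cite: Balaban1985BackgroundPropagators, p.392 (adjoints), bookkeeping] -/
theorem isAdjTr_id (w : X → ℝ) : IsAdjTr w w (LinearMap.id : Module.End ℂ (X → Matrix (Fin N) (Fin N) ℂ)) LinearMap.id := fun _ _ => rfl

/-- adjoint pairs subtract. [cite: Balaban1985BackgroundPropagators, (3.119) p.419 (A − DG′RD\*A), bookkeeping] -/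
theorem isAdjTr_sub {wX : X → ℝ} {wY : Y → ℝ} {A B : (X → Matrix (Fin N) (Fin N) ℂ) →ₗ[ℂ] (Y → Matrix (Fin N) (Fin N) ℂ)}
    {As Bs : (Y → Matrix (Fin N) (Fin N) ℂ) →ₗ[ℂ] (X → Matrix (Fin N) (Fin N) ℂ)} (hA : IsAdjTr wX wY A As) (hB : IsAdjTr wX wY B Bs) :
    IsAdjTr wX wY (A - B) (As - Bs) := by
  intro Φ Ψ
  have hl : trIP wY ((A - B) Φ) Ψ = trIP wY (A Φ) Ψ - trIP wY (B Φ) Ψ := by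
    simp only [trIP, LinearMap.sub_apply, Pi.sub_apply, Matrix.sub_apply, star_sub, sub_mul, Complex.sub_re, Finset.sum_sub_distrib, mul_sub]
  have hr : trIP wX Φ ((As - Bs) Ψ) = trIP wX Φ (As Ψ) - trIP wX Φ (Bs Ψ) := by
    simp only [trIP, LinearMap.sub_apply, Pi.sub_apply, Matrix.sub_apply, mul_sub, Complex.sub_re, Finset.sum_sub_distrib]
  rw [hl, hr, hA, hB]

/-- ★ adjoints of composites compose in reverse order: `(A ∘ B)† = B† ∘ A†`. [cite: Balaban1985BackgroundPropagators, (3.119) p.419 («(DG′RD\*)\* = DRG′D\*»), bookkeeping] -/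
theorem isAdjTr_comp {wX : X → ℝ} {wY : Y → ℝ} {wZ : Z → ℝ} {A : (Y → Matrix (Fin N) (Fin N) ℂ) →ₗ[ℂ] (Z → Matrix (Fin N) (Fin N) ℂ)}
    {As : (Z → Matrix (Fin N) (Fin N) ℂ) →ₗ[ℂ] (Y → Matrix (Fin N) (Fin N) ℂ)} {B : (X → Matrix (Fin N) (Fin N) ℂ) →ₗ[ℂ] (Y → Matrix (Fin N) (Fin N) ℂ)}
    {Bs : (Y → Matrix (Fin N) (Fin N) ℂ) →ₗ[ℂ] (X → Matrix (Fin N) (Fin N) ℂ)} (hA : IsAdjTr wY wZ A As) (hB : IsAdjTr wX wY B Bs) :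
    IsAdjTr wX wZ (A ∘ₗ B) (Bs ∘ₗ As) := by
  intro Φ Ψ
  simp only [LinearMap.comp_apply]
  rw [hA, hB]

/-- a symmetric operator is its own adjoint (the two predicates agree on the nose). [cite: Balaban1985BackgroundPropagators, Thm 3.11 p.416, bookkeeping] -/
theorem isAdjTr_of_isSymmTr {w : X → ℝ} {T : (X → Matrix (Fin N) (Fin N) ℂ) →ₗ[ℂ] (X → Matrix (Fin N) (Fin N) ℂ)} (hT : IsSymmTr w T) :
    IsAdjTr w w T T :=
  hT

end Generic

/-! ## §2 At any tables: `π† = (π)†`, `Δ`, `Δ_π`, `G̃⁻¹`, `G`, `Δ⁽²⁾_π`, `G₁⁻¹`, `G₁`, `(QGQ*)⁻¹`, `𝔊` symmetric -/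

section Letters

open scoped Matrix.Norms.L2Operator

variable {d ℓ : ℕ} {hd : 1 ≤ d + 1} {hL : Odd (ℓ + 1) ∧ 1 < ℓ + 1} {b₀ b₁ : ℝ} {N : ℕ}
variable (i : KIdx d ℓ hd hL b₀ b₁)

/-- ★ **`1 − D_U R(U) G′(U) D*_U` IS THE TRACE-ADJOINT OF `1 − D_U G′(U) R(U) D*_U`** at a unitary-valued configuration with symmetric `G′(U)`, `R(U)`
(print p. 419: the form `⟨A − DG′RD\*A, Δ(A − DG′RD\*A)⟩`; `(D)\* = D\*` (3.8), `G′`, `R` symmetric (3.25)). [cite: Balaban1985BackgroundPropagators, (3.119) p.419, (3.8) p.392, (3.25) p.395] -/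
theorem isAdjTr_gaugePiY_gaugePiTY (parS : SiteParY (Matrix (Fin N) (Fin N) ℂ) i) (Gp : SiteOpY (Matrix (Fin N) (Fin N) ℂ) i)
    (U : CfgY (Matrix (Fin N) (Fin N) ℂ) i)
    (hU : ∀ μ x, ((U μ x : (Matrix (Fin N) (Fin N) ℂ)ˣ) : Matrix (Fin N) (Fin N) ℂ) ∈ unitary (Matrix (Fin N) (Fin N) ℂ))
    (hGp : IsSymmTr (fun _ => (1 : ℝ)) (Gp U)) (hR : IsSymmTr (fun _ => (1 : ℝ)) (RY i parS Gp U)) :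
    IsAdjTr (fun _ => (1 : ℝ)) (fun _ => (1 : ℝ)) (gaugePiY i parS Gp U) (gaugePiTY i parS Gp U) := by
  have hD := isAdjTr_gradY_divY i U hU
  have h₁ : IsAdjTr (fun _ => (1 : ℝ)) (fun _ => (1 : ℝ)) (RY i parS Gp U ∘ₗ divY i U) (gradY i U ∘ₗ RY i parS Gp U) :=
    isAdjTr_comp (isAdjTr_of_isSymmTr hR) (isAdjTr_reverse hD)
  have h₂ : IsAdjTr (fun _ => (1 : ℝ)) (fun _ => (1 : ℝ)) (Gp U ∘ₗ RY i parS Gp U ∘ₗ divY i U) ((gradY i U ∘ₗ RY i parS Gp U) ∘ₗ Gp U) :=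
    isAdjTr_comp (isAdjTr_of_isSymmTr hGp) h₁
  have h₃ : IsAdjTr (fun _ => (1 : ℝ)) (fun _ => (1 : ℝ)) (gradY i U ∘ₗ Gp U ∘ₗ RY i parS Gp U ∘ₗ divY i U)
      (((gradY i U ∘ₗ RY i parS Gp U) ∘ₗ Gp U) ∘ₗ divY i U) :=
    isAdjTr_comp hD h₂
  have h := isAdjTr_sub (isAdjTr_id (N := N) (X := FBondY i) fun _ => (1 : ℝ)) h₃
  simpa only [gaugePiY, gaugePiTY, LinearMap.comp_assoc] using h

/-- ★ **THE HESSIAN `Δ(U)` (3.10) IS SYMMETRIC** at a unitary-valued configuration: `D\*𝒦D` (`coCurlY_jordanY_curlY_isSymmTr`) plus the commutator part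
(`curv2Y_isSymmTr`). [cite: Balaban1985BackgroundPropagators, (3.10) p.392 («it is a hermitian operator»)] -/
theorem hessY_isSymmTr (U : CfgY (Matrix (Fin N) (Fin N) ℂ) i)
    (hU : ∀ μ x, ((U μ x : (Matrix (Fin N) (Fin N) ℂ)ˣ) : Matrix (Fin N) (Fin N) ℂ) ∈ unitary (Matrix (Fin N) (Fin N) ℂ)) :
    IsSymmTr (fun _ => (1 : ℝ)) (hessY i U) := by
  rw [hessY]
  exact isSymmTr_add _ (coCurlY_jordanY_curlY_isSymmTr i U hU) (curv2Y_isSymmTr i U hU)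

variable (parS : SiteParY (Matrix (Fin N) (Fin N) ℂ) i) (parB : BondParY (Matrix (Fin N) (Fin N) ℂ) i) (Gp : SiteOpY (Matrix (Fin N) (Fin N) ℂ) i)
  (Δ2 : BondOpY (Matrix (Fin N) (Fin N) ℂ) i) (U : CfgY (Matrix (Fin N) (Fin N) ℂ) i)

/-- ★ **`Δ_π(U)` (3.119) IS SYMMETRIC** — an adjoint sandwich `π† Δ π` of the symmetric Hessian. [cite: Balaban1985BackgroundPropagators, (3.119) p.419] -/
theorem deltaPiY_isSymmTr
    (hU : ∀ μ x, ((U μ x : (Matrix (Fin N) (Fin N) ℂ)ˣ) : Matrix (Fin N) (Fin N) ℂ) ∈ unitary (Matrix (Fin N) (Fin N) ℂ))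
    (hGp : IsSymmTr (fun _ => (1 : ℝ)) (Gp U)) (hR : IsSymmTr (fun _ => (1 : ℝ)) (RY i parS Gp U)) :
    IsSymmTr (fun _ => (1 : ℝ)) (deltaPiY i parS Gp U) :=
  isSymmTr_sandwich_of_isAdjTr (isAdjTr_gaugePiY_gaugePiTY i parS Gp U hU hGp hR) (hessY_isSymmTr i U hU)

variable {G : Subgroup (Matrix (Fin N) (Fin N) ℂ)ˣ}

/-- ★ **`G̃⁻¹(U) = Δ_π + DRD\* + Q\*aQ` (3.122) IS SYMMETRIC** at `G`-valued data, `G ≤ U(N)`. [cite: Balaban1985BackgroundPropagators, (3.122) p.420, (3.26) p.395] -/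
theorem deltaPiAY_isSymmTr (hG : G ≤ B7Prop2Explicit.unitaryUnits (Matrix (Fin N) (Fin N) ℂ)) (hU : ∀ μ x, U μ x ∈ G)
    (hparB : ∀ s s', parB U s s' ∈ G) (hGp : IsSymmTr (fun _ => (1 : ℝ)) (Gp U)) (hR : IsSymmTr (fun _ => (1 : ℝ)) (RY i parS Gp U)) :
    IsSymmTr (fun _ => (1 : ℝ)) (deltaPiAY i parS parB Gp U) := by
  have hU' : ∀ μ x, ((U μ x : (Matrix (Fin N) (Fin N) ℂ)ˣ) : Matrix (Fin N) (Fin N) ℂ) ∈ unitary (Matrix (Fin N) (Fin N) ℂ) :=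
    fun μ x => hG (hU μ x)
  rw [deltaPiAY]
  exact isSymmTr_add _ (isSymmTr_add _ (deltaPiY_isSymmTr i parS Gp U hU' hGp hR) (gradY_RY_divY_isSymmTr i parS Gp U hU' hR))
    (isSymmTr_QsY_aY_QY i hG parB U hparB (aK_isSymm i))

/-- ★★ **SECT. D's `G(U) = G̃(U) = Ring.inverse G̃⁻¹(U)` IS SYMMETRIC** at `G`-valued data (invertible or not). [cite: Balaban1985BackgroundPropagators, (3.122)–(3.123) p.420, Thm 3.12 p.423] -/
theorem GDY_isSymmTr (hG : G ≤ B7Prop2Explicit.unitaryUnits (Matrix (Fin N) (Fin N) ℂ)) (hU : ∀ μ x, U μ x ∈ G)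
    (hparB : ∀ s s', parB U s s' ∈ G) (hGp : IsSymmTr (fun _ => (1 : ℝ)) (Gp U)) (hR : IsSymmTr (fun _ => (1 : ℝ)) (RY i parS Gp U)) :
    IsSymmTr (fun _ => (1 : ℝ)) (GDY i parS parB Gp U) :=
  isSymmTr_ringInverse _ (deltaPiAY_isSymmTr i parS parB Gp U hG hU hparB hGp hR)

/-- `Δ⁽²⁾_π(U) = π† Δ⁽²⁾(U) π` (3.135) IS SYMMETRIC when `Δ⁽²⁾(U)` is. [cite: Balaban1985BackgroundPropagators, (3.134)–(3.135) p.422] -/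
theorem delta2PiY_isSymmTr
    (hU : ∀ μ x, ((U μ x : (Matrix (Fin N) (Fin N) ℂ)ˣ) : Matrix (Fin N) (Fin N) ℂ) ∈ unitary (Matrix (Fin N) (Fin N) ℂ))
    (hGp : IsSymmTr (fun _ => (1 : ℝ)) (Gp U)) (hR : IsSymmTr (fun _ => (1 : ℝ)) (RY i parS Gp U)) (hΔ2 : IsSymmTr (fun _ => (1 : ℝ)) (Δ2 U)) :
    IsSymmTr (fun _ => (1 : ℝ)) (delta2PiY i parS Gp Δ2 U) :=
  isSymmTr_sandwich_of_isAdjTr (isAdjTr_gaugePiY_gaugePiTY i parS Gp U hU hGp hR) hΔ2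

/-- `G₁(U)⁻¹ = G̃⁻¹ − Δ⁽²⁾_π` (3.128) IS SYMMETRIC at `G`-valued data when `Δ⁽²⁾(U)` is. [cite: Balaban1985BackgroundPropagators, (3.128) p.421, (3.134) p.422] -/
theorem deltaOneY_isSymmTr (hG : G ≤ B7Prop2Explicit.unitaryUnits (Matrix (Fin N) (Fin N) ℂ)) (hU : ∀ μ x, U μ x ∈ G)
    (hparB : ∀ s s', parB U s s' ∈ G) (hGp : IsSymmTr (fun _ => (1 : ℝ)) (Gp U)) (hR : IsSymmTr (fun _ => (1 : ℝ)) (RY i parS Gp U))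
    (hΔ2 : IsSymmTr (fun _ => (1 : ℝ)) (Δ2 U)) : IsSymmTr (fun _ => (1 : ℝ)) (deltaOneY i parS parB Gp Δ2 U) := by
  rw [deltaOneY]
  exact isSymmTr_sub (deltaPiAY_isSymmTr i parS parB Gp U hG hU hparB hGp hR)
    (delta2PiY_isSymmTr i parS Gp Δ2 U (fun μ x => hG (hU μ x)) hGp hR hΔ2)

/-- ★★ **`G₁(U) = Ring.inverse G₁(U)⁻¹` (3.128)–(3.129) IS SYMMETRIC** at `G`-valued data when `Δ⁽²⁾(U)` is (invertible or not).
[cite: Balaban1985BackgroundPropagators, (3.128)–(3.129) p.421, (3.138) p.423] -/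
theorem G1Y_isSymmTr (hG : G ≤ B7Prop2Explicit.unitaryUnits (Matrix (Fin N) (Fin N) ℂ)) (hU : ∀ μ x, U μ x ∈ G)
    (hparB : ∀ s s', parB U s s' ∈ G) (hGp : IsSymmTr (fun _ => (1 : ℝ)) (Gp U)) (hR : IsSymmTr (fun _ => (1 : ℝ)) (RY i parS Gp U))
    (hΔ2 : IsSymmTr (fun _ => (1 : ℝ)) (Δ2 U)) : IsSymmTr (fun _ => (1 : ℝ)) (G1Y i parS parB Gp Δ2 U) :=
  isSymmTr_ringInverse _ (deltaOneY_isSymmTr i parS parB Gp Δ2 U hG hU hparB hGp hR hΔ2)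

/-- `(Q 𝒢 Q*)(U)` IS SYMMETRIC for any symmetric bond-sector letter `𝒢` when `Q*(U)` is the adjoint of `Q(U)`. [cite: Balaban1985BackgroundPropagators, (3.123) p.420, (3.132) p.422, (3.13) p.393] -/
theorem QGQOfY_isSymmTr (𝒢 : BondOpY (Matrix (Fin N) (Fin N) ℂ) i)
    (hQ : IsAdjTr (fun _ => (1 : ℝ)) (fun _ => (1 : ℝ)) (QY i parB U) (QsY i parB U)) (h𝒢 : IsSymmTr (fun _ => (1 : ℝ)) (𝒢 U)) :
    IsSymmTr (fun _ => (1 : ℝ)) (QGQOfY i parB 𝒢 U) :=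
  isSymmTr_sandwich_of_isAdjTr (isAdjTr_reverse hQ) h𝒢

/-- `(Q 𝒢 Q*)⁻¹(U)` IS SYMMETRIC for any symmetric letter `𝒢` (invertible or not). [cite: Balaban1985BackgroundPropagators, (3.123) p.420, (3.132) p.422] -/
theorem QGQinvOfY_isSymmTr (𝒢 : BondOpY (Matrix (Fin N) (Fin N) ℂ) i)
    (hQ : IsAdjTr (fun _ => (1 : ℝ)) (fun _ => (1 : ℝ)) (QY i parB U) (QsY i parB U)) (h𝒢 : IsSymmTr (fun _ => (1 : ℝ)) (𝒢 U)) :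
    IsSymmTr (fun _ => (1 : ℝ)) (QGQinvOfY i parB 𝒢 U) :=
  isSymmTr_ringInverse _ (QGQOfY_isSymmTr i parB U 𝒢 hQ h𝒢)

/-- `(QG₁Q*)⁻¹(U)` (3.132) IS SYMMETRIC at `G`-valued data when `Δ⁽²⁾(U)` is. [cite: Balaban1985BackgroundPropagators, (3.132) p.422] -/
theorem QG1QinvY_isSymmTr (hG : G ≤ B7Prop2Explicit.unitaryUnits (Matrix (Fin N) (Fin N) ℂ)) (hU : ∀ μ x, U μ x ∈ G)
    (hparB : ∀ s s', parB U s s' ∈ G) (hGp : IsSymmTr (fun _ => (1 : ℝ)) (Gp U)) (hR : IsSymmTr (fun _ => (1 : ℝ)) (RY i parS Gp U))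
    (hΔ2 : IsSymmTr (fun _ => (1 : ℝ)) (Δ2 U)) : IsSymmTr (fun _ => (1 : ℝ)) (QG1QinvY i parS parB Gp Δ2 U) :=
  QGQinvOfY_isSymmTr i parB U (G1Y i parS parB Gp Δ2) (isAdjTr_QY_QsY i hG parB U hparB) (G1Y_isSymmTr i parS parB Gp Δ2 U hG hU hparB hGp hR hΔ2)

/-- ★★ **`𝔊(U) = 𝔓G₁ = G₁ − G₁Q\*(QG₁Q\*)⁻¹QG₁ − G₁DRD\*G₁` (3.153) IS SYMMETRIC** at `G`-valued data when `Δ⁽²⁾(U)` is — which is WHY print's two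
expressions `𝔓G₁ = G₁𝔓\*` agree. [cite: Balaban1985BackgroundPropagators, (3.153) p.426, (3.147) p.425] -/
theorem GGY_isSymmTr (hG : G ≤ B7Prop2Explicit.unitaryUnits (Matrix (Fin N) (Fin N) ℂ)) (hU : ∀ μ x, U μ x ∈ G)
    (hparB : ∀ s s', parB U s s' ∈ G) (hGp : IsSymmTr (fun _ => (1 : ℝ)) (Gp U)) (hR : IsSymmTr (fun _ => (1 : ℝ)) (RY i parS Gp U))
    (hΔ2 : IsSymmTr (fun _ => (1 : ℝ)) (Δ2 U)) : IsSymmTr (fun _ => (1 : ℝ)) (GGY i parS parB Gp Δ2 U) := by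
  have hU' : ∀ μ x, ((U μ x : (Matrix (Fin N) (Fin N) ℂ)ˣ) : Matrix (Fin N) (Fin N) ℂ) ∈ unitary (Matrix (Fin N) (Fin N) ℂ) :=
    fun μ x => hG (hU μ x)
  have hQ : IsAdjTr (fun _ => (1 : ℝ)) (fun _ => (1 : ℝ)) (QY i parB U) (QsY i parB U) := isAdjTr_QY_QsY i hG parB U hparB
  have h1 : IsSymmTr (fun _ => (1 : ℝ)) (G1Y i parS parB Gp Δ2 U) := G1Y_isSymmTr i parS parB Gp Δ2 U hG hU hparB hGp hR hΔ2
  have hB : IsSymmTr (fun _ => (1 : ℝ)) (QG1QinvY i parS parB Gp Δ2 U) := QG1QinvY_isSymmTr i parS parB Gp Δ2 U hG hU hparB hGp hR hΔ2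
  have hS : IsSymmTr (fun _ => (1 : ℝ)) (QsY i parB U ∘ₗ QG1QinvY i parS parB Gp Δ2 U ∘ₗ QY i parB U) := isSymmTr_sandwich_of_isAdjTr hQ hB
  have hT₁ : IsSymmTr (fun _ => (1 : ℝ))
      (G1Y i parS parB Gp Δ2 U ∘ₗ (QsY i parB U ∘ₗ QG1QinvY i parS parB Gp Δ2 U ∘ₗ QY i parB U) ∘ₗ G1Y i parS parB Gp Δ2 U) :=
    isSymmTr_sandwich_of_isAdjTr (Q := G1Y i parS parB Gp Δ2 U) (Qs := G1Y i parS parB Gp Δ2 U) (isAdjTr_of_isSymmTr h1) hS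
  have hT₂ : IsSymmTr (fun _ => (1 : ℝ))
      (G1Y i parS parB Gp Δ2 U ∘ₗ (gradY i U ∘ₗ RY i parS Gp U ∘ₗ divY i U) ∘ₗ G1Y i parS parB Gp Δ2 U) :=
    isSymmTr_sandwich_of_isAdjTr (Q := G1Y i parS parB Gp Δ2 U) (Qs := G1Y i parS parB Gp Δ2 U) (isAdjTr_of_isSymmTr h1)
      (gradY_RY_divY_isSymmTr i parS Gp U hU' hR)
  rw [GGY_eq_3153]
  refine isSymmTr_sub (isSymmTr_sub h1 ?_) ?_
  · simpa only [LinearMap.comp_assoc] using hT₁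
  · simpa only [LinearMap.comp_assoc] using hT₂

end Letters

/-! ## §3 At def-Y's symmetrised tables `parSymY ∕ parBY ∕ GpY (parSymY)`: the table inputs DISCHARGED for a `G`-valued configuration -/

section SymTables

open scoped Matrix.Norms.L2Operator

variable {d ℓ : ℕ} {hd : 1 ≤ d + 1} {hL : Odd (ℓ + 1) ∧ 1 < ℓ + 1} {b₀ b₁ : ℝ} {N : ℕ}
variable (i : KIdx d ℓ hd hL b₀ b₁) {G : Subgroup (Matrix (Fin N) (Fin N) ℂ)ˣ}

/-- ★★ **SECT. D's `G(U)` OVER def-Y's SYMMETRISED TABLES IS SYMMETRIC** for every `G`-valued configuration, `G ≤ U(N)` — no hypothesis left.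
[cite: Balaban1985BackgroundPropagators, (3.122)–(3.123) p.420, (3.35) p.396] -/
theorem GDY_isSymmTr_parSymY (hG : G ≤ B7Prop2Explicit.unitaryUnits (Matrix (Fin N) (Fin N) ℂ)) {U : CfgY (Matrix (Fin N) (Fin N) ℂ) i}
    (hU : ∀ μ x, U μ x ∈ G) : IsSymmTr (fun _ => (1 : ℝ)) (GDY i (parSymY i) (parBY i) (GpY i (parSymY i)) U) :=
  GDY_isSymmTr i (parSymY i) (parBY i) (GpY i (parSymY i)) U hG hU (fun s s' => parBY_mem i hU s s') (isSymmTr_GpY_parSymY i hG hU)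
    (RY_parSymY_isSymmTr i hG hU)

/-- ★★ `G₁(U)` over def-Y's symmetrised tables IS SYMMETRIC for a `G`-valued configuration, given a symmetric residual letter `Δ⁽²⁾(U)`.
[cite: Balaban1985BackgroundPropagators, (3.128)–(3.129) p.421, (3.35) p.396] -/
theorem G1Y_isSymmTr_parSymY (hG : G ≤ B7Prop2Explicit.unitaryUnits (Matrix (Fin N) (Fin N) ℂ)) {U : CfgY (Matrix (Fin N) (Fin N) ℂ) i}
    (hU : ∀ μ x, U μ x ∈ G) (Δ2 : BondOpY (Matrix (Fin N) (Fin N) ℂ) i) (hΔ2 : IsSymmTr (fun _ => (1 : ℝ)) (Δ2 U)) :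
    IsSymmTr (fun _ => (1 : ℝ)) (G1Y i (parSymY i) (parBY i) (GpY i (parSymY i)) Δ2 U) :=
  G1Y_isSymmTr i (parSymY i) (parBY i) (GpY i (parSymY i)) Δ2 U hG hU (fun s s' => parBY_mem i hU s s') (isSymmTr_GpY_parSymY i hG hU)
    (RY_parSymY_isSymmTr i hG hU) hΔ2

/-- ★★ `𝔊(U)` (3.153) over def-Y's symmetrised tables IS SYMMETRIC for a `G`-valued configuration, given a symmetric residual letter `Δ⁽²⁾(U)`.
[cite: Balaban1985BackgroundPropagators, (3.153) p.426, (3.35) p.396] -/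
theorem GGY_isSymmTr_parSymY (hG : G ≤ B7Prop2Explicit.unitaryUnits (Matrix (Fin N) (Fin N) ℂ)) {U : CfgY (Matrix (Fin N) (Fin N) ℂ) i}
    (hU : ∀ μ x, U μ x ∈ G) (Δ2 : BondOpY (Matrix (Fin N) (Fin N) ℂ) i) (hΔ2 : IsSymmTr (fun _ => (1 : ℝ)) (Δ2 U)) :
    IsSymmTr (fun _ => (1 : ℝ)) (GGY i (parSymY i) (parBY i) (GpY i (parSymY i)) Δ2 U) :=
  GGY_isSymmTr i (parSymY i) (parBY i) (GpY i (parSymY i)) Δ2 U hG hU (fun s s' => parBY_mem i hU s s') (isSymmTr_GpY_parSymY i hG hU)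
    (RY_parSymY_isSymmTr i hG hU) hΔ2

end SymTables

/-! ## §4 At the v4 record `lettersYOfRecordV4 N θ M⋆ 𝔯`: the certificate's `hsymD`, modulo the symmetry of the residual PARAMETER `𝔯` -/

section Residual

open scoped Matrix.Norms.L2Operator

variable {d ℓ : ℕ} {hd : 1 ≤ d + 1} {hL : Odd (ℓ + 1) ∧ 1 < ℓ + 1} {b₀ b₁ : ℝ} {Mstar N : ℕ}

/-- the zero operator is symmetric. [cite: Balaban1985BackgroundPropagators, (3.134) p.422, bookkeeping] -/
theorem isSymmTr_zero {S : Type} [Fintype S] (w : S → ℝ) :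
    IsSymmTr w (0 : (S → Matrix (Fin N) (Fin N) ℂ) →ₗ[ℂ] (S → Matrix (Fin N) (Fin N) ℂ)) := by
  intro Φ Ψ
  rw [LinearMap.zero_apply, LinearMap.zero_apply, B9Ineq349SiteAdjoint.trIP_comm, B9Thm311ReadingCoords.trIP_zero_right,
    B9Thm311ReadingCoords.trIP_zero_right]

/-- the flat residual letter `Δ⁽²⁾ := 0` (`resLettersY_flat`) is symmetric at every configuration. [cite: Balaban1985BackgroundPropagators, (3.134) p.422, bookkeeping] -/
theorem resLettersY_flat_Δ2_isSymmTr (x : MemberY d ℓ hd hL b₀ b₁ Mstar) (U : CfgY (Matrix (Fin N) (Fin N) ℂ) x.toKIdx) :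
    IsSymmTr (fun _ => (1 : ℝ)) ((resLettersY_flat (Matrix (Fin N) (Fin N) ℂ) x).Δ2 U) :=
  isSymmTr_zero _

end Residual

section Record

open scoped Matrix.Norms.L2Operator

variable {N : ℕ} (θ : Stage3Params) (Mstar : ℕ) (𝔯 : ResY N θ Mstar) {G : Subgroup (Matrix (Fin N) (Fin N) ℂ)ˣ}

/-- the flat residual family `resY_flat` is symmetric at every member and configuration. [cite: Balaban1985BackgroundPropagators, (3.134) p.422, bookkeeping] -/
theorem resY_flat_Δ2_isSymmTr (x : MemberY θ.d₆ θ.ℓ₆ θ.hd' θ.hL' θ.b₀ θ.b₁ Mstar) (U : CfgY (Matrix (Fin N) (Fin N) ℂ) x.toKIdx) :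
    IsSymmTr (fun _ => (1 : ℝ)) ((resY_flat N θ Mstar x).Δ2 U) :=
  isSymmTr_zero _

/-- ★★★ **THE RECORD'S `GD` IS SYMMETRIC** at every `G`-valued configuration, `G ≤ U(N)` — NO residual hypothesis (Sect. D's `G̃` does not see `Δ⁽²⁾`).
[cite: Balaban1985BackgroundPropagators, (3.122)–(3.123) p.420, (3.35) p.396] -/
theorem lettersYOfRecordV4_GD_isSymmTr (hG : G ≤ B7Prop2Explicit.unitaryUnits (Matrix (Fin N) (Fin N) ℂ))
    (x : MemberY θ.d₆ θ.ℓ₆ θ.hd' θ.hL' θ.b₀ θ.b₁ Mstar) {U : CfgY (Matrix (Fin N) (Fin N) ℂ) x.toKIdx} (hU : ∀ μ z, U μ z ∈ G) :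
    IsSymmTr (fun _ => (1 : ℝ)) ((lettersYOfRecordV4 N θ Mstar 𝔯 x).GD U) :=
  GDY_isSymmTr_parSymY x.toKIdx hG hU

/-- ★★ **THE RECORD'S `G₁` IS SYMMETRIC** at every `G`-valued configuration at which the residual letter `(𝔯 x).Δ2` is.
[cite: Balaban1985BackgroundPropagators, (3.128)–(3.129) p.421, (3.35) p.396] -/
theorem lettersYOfRecordV4_G₁_isSymmTr (hG : G ≤ B7Prop2Explicit.unitaryUnits (Matrix (Fin N) (Fin N) ℂ))
    (x : MemberY θ.d₆ θ.ℓ₆ θ.hd' θ.hL' θ.b₀ θ.b₁ Mstar) {U : CfgY (Matrix (Fin N) (Fin N) ℂ) x.toKIdx} (hU : ∀ μ z, U μ z ∈ G)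
    (hΔ2 : IsSymmTr (fun _ => (1 : ℝ)) ((𝔯 x).Δ2 U)) : IsSymmTr (fun _ => (1 : ℝ)) ((lettersYOfRecordV4 N θ Mstar 𝔯 x).G₁ U) :=
  G1Y_isSymmTr_parSymY x.toKIdx hG hU (𝔯 x).Δ2 hΔ2

/-- ★★ **THE RECORD'S `GG = 𝔊` IS SYMMETRIC** at every `G`-valued configuration at which the residual letter `(𝔯 x).Δ2` is.
[cite: Balaban1985BackgroundPropagators, (3.153) p.426, (3.35) p.396] -/
theorem lettersYOfRecordV4_GG_isSymmTr (hG : G ≤ B7Prop2Explicit.unitaryUnits (Matrix (Fin N) (Fin N) ℂ))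
    (x : MemberY θ.d₆ θ.ℓ₆ θ.hd' θ.hL' θ.b₀ θ.b₁ Mstar) {U : CfgY (Matrix (Fin N) (Fin N) ℂ) x.toKIdx} (hU : ∀ μ z, U μ z ∈ G)
    (hΔ2 : IsSymmTr (fun _ => (1 : ℝ)) ((𝔯 x).Δ2 U)) : IsSymmTr (fun _ => (1 : ℝ)) ((lettersYOfRecordV4 N θ Mstar 𝔯 x).GG U) :=
  GGY_isSymmTr_parSymY x.toKIdx hG hU (𝔯 x).Δ2 hΔ2

/-- ★★★ **EDITION 7's `hsymD` AT THE RECORD** (`GD ∧ G₁`, special-unitary configurations) FROM ONE DISPLAYED HYPOTHESIS ON THE RESIDUAL PARAMETER: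
`hΔ2 : ∀ x U, (∀ μ z, U μ z ∈ SU(N)) → IsSymmTr 1 ((𝔯 x).Δ2 U)` (print's (3.134): `Δ⁽²⁾` is the operator OF A QUADRATIC FORM `2⟨HC⁽²⁾(A), J⟩`, symmetric by
construction — displayed, since `Δ⁽²⁾` is a parameter here). [cite: Balaban1985BackgroundPropagators, (3.122) p.420, (3.128) p.421, (3.134) p.422, (3.35) p.396] -/
theorem lettersYOfRecordV4_symmDG₁
    (hΔ2 : ∀ (x : MemberY θ.d₆ θ.ℓ₆ θ.hd' θ.hL' θ.b₀ θ.b₁ Mstar) (U : CfgY (Matrix (Fin N) (Fin N) ℂ) x.toKIdx), (∀ μ z, U μ z ∈ specialUnitaryUnits (Fin N)) →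
      IsSymmTr (fun _ => (1 : ℝ)) ((𝔯 x).Δ2 U)) :
    ∀ (x : MemberY θ.d₆ θ.ℓ₆ θ.hd' θ.hL' θ.b₀ θ.b₁ Mstar) (U : CfgY (Matrix (Fin N) (Fin N) ℂ) x.toKIdx), (∀ μ z, U μ z ∈ specialUnitaryUnits (Fin N)) →
      IsSymmTr (fun _ => (1 : ℝ)) ((lettersYOfRecordV4 N θ Mstar 𝔯 x).GD U) ∧ IsSymmTr (fun _ => (1 : ℝ)) ((lettersYOfRecordV4 N θ Mstar 𝔯 x).G₁ U) :=
  fun x U hU => ⟨lettersYOfRecordV4_GD_isSymmTr θ Mstar 𝔯 specialUnitaryUnits_le_unitaryUnits x hU,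
    lettersYOfRecordV4_G₁_isSymmTr θ Mstar 𝔯 specialUnitaryUnits_le_unitaryUnits x hU (hΔ2 x U hU)⟩

/-- ★★★ **EDITION 8's `hsymD` AT THE RECORD** (`GD ∧ G₁ ∧ GG`, special-unitary configurations) from the same displayed hypothesis on `𝔯`.
[cite: Balaban1985BackgroundPropagators, (3.122) p.420, (3.128) p.421, (3.153) p.426, (3.35) p.396] -/
theorem lettersYOfRecordV4_symmDG₁GG
    (hΔ2 : ∀ (x : MemberY θ.d₆ θ.ℓ₆ θ.hd' θ.hL' θ.b₀ θ.b₁ Mstar) (U : CfgY (Matrix (Fin N) (Fin N) ℂ) x.toKIdx), (∀ μ z, U μ z ∈ specialUnitaryUnits (Fin N)) →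
      IsSymmTr (fun _ => (1 : ℝ)) ((𝔯 x).Δ2 U)) :
    ∀ (x : MemberY θ.d₆ θ.ℓ₆ θ.hd' θ.hL' θ.b₀ θ.b₁ Mstar) (U : CfgY (Matrix (Fin N) (Fin N) ℂ) x.toKIdx), (∀ μ z, U μ z ∈ specialUnitaryUnits (Fin N)) →
      IsSymmTr (fun _ => (1 : ℝ)) ((lettersYOfRecordV4 N θ Mstar 𝔯 x).GD U) ∧ IsSymmTr (fun _ => (1 : ℝ)) ((lettersYOfRecordV4 N θ Mstar 𝔯 x).G₁ U) ∧
        IsSymmTr (fun _ => (1 : ℝ)) ((lettersYOfRecordV4 N θ Mstar 𝔯 x).GG U) :=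
  fun x U hU => ⟨lettersYOfRecordV4_GD_isSymmTr θ Mstar 𝔯 specialUnitaryUnits_le_unitaryUnits x hU,
    lettersYOfRecordV4_G₁_isSymmTr θ Mstar 𝔯 specialUnitaryUnits_le_unitaryUnits x hU (hΔ2 x U hU),
    lettersYOfRecordV4_GG_isSymmTr θ Mstar 𝔯 specialUnitaryUnits_le_unitaryUnits x hU (hΔ2 x U hU)⟩

/-- ★ at the FLAT residual family `resY_flat` the three symmetries are UNCONDITIONAL. [cite: Balaban1985BackgroundPropagators, (3.122) p.420, (3.128) p.421, (3.153) p.426, bookkeeping] -/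
theorem lettersYOfRecordV4_flat_symmDG₁GG :
    ∀ (x : MemberY θ.d₆ θ.ℓ₆ θ.hd' θ.hL' θ.b₀ θ.b₁ Mstar) (U : CfgY (Matrix (Fin N) (Fin N) ℂ) x.toKIdx), (∀ μ z, U μ z ∈ specialUnitaryUnits (Fin N)) →
      IsSymmTr (fun _ => (1 : ℝ)) ((lettersYOfRecordV4 N θ Mstar (resY_flat N θ Mstar) x).GD U) ∧
        IsSymmTr (fun _ => (1 : ℝ)) ((lettersYOfRecordV4 N θ Mstar (resY_flat N θ Mstar) x).G₁ U) ∧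
          IsSymmTr (fun _ => (1 : ℝ)) ((lettersYOfRecordV4 N θ Mstar (resY_flat N θ Mstar) x).GG U) :=
  lettersYOfRecordV4_symmDG₁GG θ Mstar (resY_flat N θ Mstar) fun x U _ => resY_flat_Δ2_isSymmTr θ Mstar x U

end Record

end Literature.MathematicalPhysics.QuantumFieldTheory.Balaban1983to89.Node00

end
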